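import Summits.HodgeConjecture.HodgeConjecture.Theorems.BoundaryReadoutHCOverNumberFieldsArithmeticForms
import Literature.AlgebraicGeometry.HodgeTheory.MiddleDimensionReductionOfHodgeModels
import Literature.AlgebraicGeometry.HodgeTheory.MiddleDimensionReductionHolds
import Literature.AlgebraicGeometry.Motives.BaseChangeProofs
import HarnessLib

/-!
# Route BoundaryReadout — crux `HCOverNumberFields` (stmt-HodgeConjecture-1070): reduction to
# middle-dimensional Hodge classes on even-dimensional ARITHMETIC varieties

Helper file for the crux item stmt-HodgeConjecture-1070 (it closes nothing; the crux — the Hodge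
conjecture for smooth projective complex varieties definable over a number field — is open). It
proves the arithmetic form of the reduction of the Hodge conjecture to the middle dimension
(P. Brosnan, H. Fang, Z. Nie, G. Pearlstein, Invent. Math. 177 (2009), §6 Lemma 48; the tree's
`middleDimensionReduction_holds` is the ABSOLUTE form, whose hypothesis quantifies over ALL
even-dimensional smooth projective complex varieties and is therefore useless for the arithmetic
crux as stated):

  `hcOverNumberFields_iff_middleDimension :
     HCOverNumberFields ↔ ∀ m ≥ 2, ∀ X smooth projective of dimension 2m DEFINABLE OVER A NUMBER
       FIELD, every rational (m,m) class in H^{2m}(X(ℂ); ℂ) is algebraic`.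

So the crux lives exactly where the classical candidate counterexamples live: Weil classes on a CM
abelian variety of Weil type of dimension `2m` are middle-dimensional classes on an arithmetic
variety.

## Proof

By the landed `hcOverNumberFields_iff_deepMiddle` (Lefschetz `(1,1)` and hard Lefschetz fold every
codimension onto `2 ≤ p`, `2p ≤ n`) it suffices to treat a rational `(p,p)` class `c` on an
arithmetic `n`-fold `X` with `2 ≤ p` and `r := n − 2p ≥ 1`. The PRODUCT HALF of BFNP Lemma 48 is
re-run with its middle-dimensional hypothesis LOCALISED to the one auxiliary variety it uses,
`V = X × ℙʳ` (`mem_algebraicClasses_of_two_mul_add_eq_of_middle_tensor`, adapted verbatim from the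
tree's `mem_algebraicClasses_of_two_mul_add_eq_of_cupPreservesHodgeType`, file
`MiddleDimensionReductionOfHodgeModels`, with its three Hodge-theoretic inputs fed by the discharged
theorems `nonempty_hodgeModel_holds`, `hodgePQ_independent_of_hodgeModel_holds`,
`exists_deRhamIsoFamily_holds`): `c' = pr₁^* c ∪ pr₂^* ρ` (`ρ ≠ 0` a rational top class of `ℙʳ`)
is a rational `(p+r, p+r)` class in the middle degree of the `2(p+r)`-fold `V`, algebraic by
hypothesis, and `c = λ⁻¹ pr_{1*} c'` with `λ ≠ 0` is algebraic since `pr_{1*}` respects the coniveau.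
And `V` IS ARITHMETIC when `X` is (`exists_iso_baseChangeHom_tensor_projectiveSpace`): base change
along `σ : K →+* ℂ` is monoidal for the cartesian structures (`exists_tensorIso_baseChangeHom`,
Hartshorne II.3 Thm. 3.3) and `ℙʳ_ℂ ≅ ℙʳ_K ⊗_{K,σ} ℂ` (`projectiveSpaceBaseChangeIso`, Liu Ex. 3.1.10),
so `X ≅ X₀ ⊗_σ ℂ` gives `X × ℙʳ_ℂ ≅ (X₀ ×_K ℙʳ_K) ⊗_σ ℂ`. Here `p + r = n − p ≥ 2`.

No definition, no named-fact hypothesis, no `sorry`; standard axioms.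

## References

* [BrosnanFangNiePearlstein2009] P. Brosnan, H. Fang, Z. Nie, G. Pearlstein, Singularities of
  admissible normal functions, Invent. Math. 177 (2009), §6 Lemma 48 (arXiv:0711.0964, p. 13).
* [VoisinHodgeI2002] C. Voisin, Hodge Theory and Complex Algebraic Geometry I, §7.3.2, §11.1.2,
  Thm. 6.25, Thm. 11.30.
* [Hartshorne1977] R. Hartshorne, Algebraic Geometry, II.3 Thm. 3.3.
* [Liu2002] Q. Liu, Algebraic Geometry and Arithmetic Curves, Ex. 3.1.10.
* [Deligne1982HodgeCycles] P. Deligne, Hodge cycles on abelian varieties, LNM 900 (1982), §4–5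
  (Weil classes).
-/

-- every declaration of this problem lives in `Summit.HodgeConjecture.HodgeConjecture.…` (summit = sub-problem)
set_option linter.dupNamespace false

noncomputable section

namespace Summit.HodgeConjecture.HodgeConjecture.Theorems

open scoped Manifold
open CategoryTheory CategoryTheory.Limits AlgebraicGeometry MonoidalCategory CartesianMonoidalCategory
open Literature.AlgebraicTopology.SingularHomology
open Literature.AlgebraicGeometry.Motives Literature.AlgebraicGeometry.HodgeTheory
open Summit.HodgeConjecture.HodgeConjecture.Theses

/-! ### The product half of BFNP Lemma 48 with a localised middle-dimensional hypothesis -/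

/-- **The product half of BFNP Lemma 48 on ONE variety.** Let `X` be smooth projective over `ℂ` of
dimension `n = 2p + r`, `r ≥ 1`, and suppose every rational middle-degree Hodge class of the single
`2(p+r)`-fold `X × ℙʳ` is algebraic. Then every rational `(p,p)` class `c ∈ H²ᵖ(X(ℂ); ℂ)` is
algebraic: with a rational top class `ρ ≠ 0` of `ℙʳ` (of type `(r,r)`), `c' = pr₁^* c ∪ pr₂^* ρ` is a
rational `(p+r, p+r)` class in the middle degree of `X × ℙʳ`, hence algebraic, and
`c = λ⁻¹ pr_{1*} c'` (`pr_{1*} pr₂^* ρ = λ · 1`, `λ ≠ 0` by Thom–Gysin exactness along a slice and the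
injectivity of `pr₂^*`), where `pr_{1*}` maps `N^{p+r} H^{2(p+r)}` into `Nᵖ H²ᵖ`. The proof is the
tree's `mem_algebraicClasses_of_two_mul_add_eq_of_cupPreservesHodgeType` verbatim, with the global
middle-dimensional hypothesis replaced by its instance on `X × ℙʳ` and the Hodge-theoretic inputs
(Hodge models, independence of `H^{p,q}` from the model, de Rham's theorem) fed by the discharged
theorems of the tree. [cite: BrosnanFangNiePearlstein2009, §6 Lemma 48 (proof, case dim Y < 2k)]
[cite: VoisinHodgeI2002, §7.3.2 and §11.1.2] -/
theorem mem_algebraicClasses_of_two_mul_add_eq_of_middle_tensor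
    {n : ℕ} {X : SchemeOver ℂ} (hX : IsSmoothProjective n X) {p r : ℕ}
    (hr : 2 * p + r = n) (hr1 : 1 ≤ r)
    (hmid : ∀ c' : complexBetti (X ⊗ projectiveSpace r ℂ) (2 * (p + r)), IsRationalClass c' →
      IsOfHodgeType (2 * (p + r)) (X ⊗ projectiveSpace r ℂ) (2 * (p + r)) (p + r) (p + r) c' →
        c' ∈ algebraicClasses (X ⊗ projectiveSpace r ℂ) (p + r))
    (c : complexBetti X (2 * p)) (hc : IsRationalClass c) (hpp : IsOfHodgeType n X (2 * p) p p c) :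
    c ∈ algebraicClasses X p := by
  -- the three Hodge-theoretic inputs, all theorems of the tree
  have hI : hodgePQ_independent_of_hodgeModel := hodgePQ_independent_of_hodgeModel_holds
  have hA : ∀ ⦃n : ℕ⦄ ⦃X : SchemeOver ℂ⦄, nonempty_hodgeModel n X :=
    fun _ _ ↦ nonempty_hodgeModel_holds
  have hdR : ∀ (E : Type) [NormedAddCommGroup E] [NormedSpace ℂ E] [FiniteDimensional ℂ E],
      Literature.NumberTheory.Transcendental.exists_deRhamIsoFamily 𝓘(ℝ, E) :=
    fun E _ _ _ ↦ Literature.NumberTheory.Transcendental.exists_deRhamIsoFamily_holds E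
  have hcup : ∀ ⦃n : ℕ⦄ ⦃X : SchemeOver ℂ⦄, IsSmoothProjective n X → CupPreservesHodgeType n X :=
    fun _ _ hX ↦ cupPreservesHodgeType_of_nonempty_hodgeModel hI (@hA _ _) hdR hX
  -- an orientation family (orientations of the closed manifolds `Y(ℂ)` exist) and its duality
  let μ : OrientationFamily := fun n Y hY ↦ (ComplexPoints.isOrientableOver ℂ hY).some
  have hμ : μ.HasPoincareDuality := OrientationFamily.hasPoincareDuality μ
  have hS := gysinMap_restrictCompl_eq_zero_of_field.{0, 0} ℂ
  -- the auxiliary factor `P = ℙʳ`, a complex point `t`, the even-dimensional `V = X × P`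
  set P := projectiveSpace r ℂ with hPdef
  have hP : IsSmoothProjective r P := isSmoothProjective_projectiveSpace_holds ℂ r
  haveI := connectedSpace_complexPoints hP
  obtain ⟨t⟩ : Nonempty (ComplexPoints P) := inferInstance
  haveI := connectedSpace_complexPoints hX
  obtain ⟨x₀⟩ : Nonempty (ComplexPoints X) := inferInstance
  have hV : IsSmoothProjective (n + r) (X ⊗ P) := IsSmoothProjective.tensor_holds hX hP
  haveI : LocallyOfFiniteType P.hom := locallyOfFiniteType_of_isSmoothProjective hP
  haveI : IsClosedImmersion (sliceAt X t).left := isClosedImmersion_sliceAt_left t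
  haveI := pathConnectedSpace_complexPoints hX
  -- a non-zero rational top-degree class `ρ` on `P`, of type `(r, r)`
  obtain ⟨ρ, hρ, hρ0⟩ := exists_isRationalClass_ne_zero_of_degree_eq_two_mul hP
  obtain ⟨B⟩ := (hA (n := r) (X := P)).nonempty hP
  have hρtyp : IsOfHodgeType r P (2 * r) r r ρ := isOfHodgeType_of_degree_eq_two_mul B ρ
  -- `pr₂^* ρ` dies off the slice `s_t(X) = pr₂⁻¹(t)` …
  have hρsupp : complexBetti.restrictCompl (X ⊗ P) (Set.range (sliceAt X t).left.base)
      (2 * r) (complexBetti.map (snd X P) (2 * r) ρ) = 0 := by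
    rw [range_sliceAt_left_base]
    exact complexBetti.restrictCompl_map_eq_zero (snd X P) (restrictCompl_pt_eq_zero hP hr1 t ρ)
  -- … hence is a Gysin image `s_{t*} y`, `y ∈ H⁰(X(ℂ); ℂ) = ℂ · 1`: `pr₂^* ρ = λ · s_{t*} 1`
  obtain ⟨y, hy⟩ := exists_complexGysin_eq_of_isClosedImmersion μ hV hX (sliceAt X t)
    (show 0 + 2 * (n + r) = 2 * r + 2 * n by ring) hρsupp
  obtain ⟨lam, rfl⟩ := singularCohomology.exists_eq_smul_one y
  rw [map_smul] at hy
  -- `λ ≠ 0`: `pr₂^*` is injective (`pr₂` has the section `(x₀, 𝟙)`) and `ρ ≠ 0`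
  have hlam : lam ≠ 0 := by
    rintro rfl
    rw [zero_smul] at hy
    apply hρ0
    let j : P ⟶ X ⊗ P := CartesianMonoidalCategory.lift (toSpecOver P ≫ x₀) (𝟙 P)
    have hj : j ≫ snd X P = 𝟙 P := CartesianMonoidalCategory.lift_snd _ _
    have hρj : complexBetti.map j (2 * r) (complexBetti.map (snd X P) (2 * r) ρ) = ρ := by
      rw [← CategoryTheory.comp_apply, ← complexBetti.map_comp, hj, complexBetti.map_id,
        CategoryTheory.id_apply]
    rw [← hρj, ← hy, map_zero]
  -- the middle-degree class `c' = pr₁^* c ∪ pr₂^* ρ` on `V`: rational, of type `(p + r, p + r)`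
  set c' : complexBetti (X ⊗ P) (2 * (p + r)) :=
    cupProduct (show 2 * p + 2 * r = 2 * (p + r) by ring) (complexBetti.map (fst X P) (2 * p) c)
      (complexBetti.map (snd X P) (2 * r) ρ) with hc'def
  have hc'rat : IsRationalClass c' := (hc.map _).cup _ (hρ.map _)
  have hc'typ : IsOfHodgeType (n + r) (X ⊗ P) (2 * (p + r)) (p + r) (p + r) c' :=
    hcup hV _ (preservesHodgeType_of_nonempty_hodgeModel hI (hA (X := X ⊗ P)) hV hX (fst X P) hpp)
      (preservesHodgeType_of_nonempty_hodgeModel hI (hA (X := X ⊗ P)) hV hP (snd X P) hρtyp)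
  -- `V` has the even dimension `n + r = 2(p + r)`: `c'` is algebraic by hypothesis
  have hdim : n + r = 2 * (p + r) := by omega
  rw [hdim] at hc'typ
  have halg : c' ∈ algebraicClasses (X ⊗ P) (p + r) := hmid c' hc'rat hc'typ
  -- `pr_{1*} c' ∈ Nᵖ H²ᵖ(X(ℂ); ℂ)` (Gysin maps and supports)
  have hpush : complexGysin μ hV hX (fst X P) (show 2 * (p + r) + 2 * n = 2 * p + 2 * (n + r) by ring)
      c' ∈ algebraicClasses X p :=
    complexGysin_mem_supportedClasses hS μ hμ hV hX (fst X P) _ (by omega) halg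
  -- `pr_{1*} c' = c ∪ pr_{1*} pr₂^* ρ = c ∪ λ · (s_t ≫ pr₁)_* 1 = λ c`
  have hone : complexGysin μ hV hX (fst X P) (show 2 * r + 2 * n = 0 + 2 * (n + r) by ring)
      (complexBetti.map (snd X P) (2 * r) ρ) = lam • singularCohomology.one ℂ (ComplexPoints X) := by
    rw [← hy, map_smul, ← LinearMap.comp_apply,
      ← complexGysin_comp hμ hX hV hX (sliceAt X t) (fst X P)]
    simp only [sliceAt_fst]
    rw [complexGysin_id hμ hX 0, LinearMap.id_apply]
  have hcc : complexGysin μ hV hX (fst X P) (show 2 * (p + r) + 2 * n = 2 * p + 2 * (n + r) by ring)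
      c' = lam • c := by
    rw [hc'def, complexGysin_cup hμ hV hX (fst X P) _ _
      (show 2 * r + 2 * n = 0 + 2 * (n + r) by ring) (Nat.add_zero (2 * p)), hone,
      LinearMap.map_smul, cupProduct_one]
  rw [hcc] at hpush
  have h := Submodule.smul_mem _ lam⁻¹ hpush
  rwa [smul_smul, inv_mul_cancel₀ hlam, one_smul] at h

/-! ### Products of arithmetic varieties with projective spaces are arithmetic -/

/-- **`X × ℙʳ` is definable over the number field of definition of `X`.** If `X ≅ X₀ ⊗_{K,σ} ℂ`,
then `X × ℙʳ_ℂ ≅ (X₀ ×_K ℙʳ_K) ⊗_{K,σ} ℂ` over `ℂ`: base change along `σ` is monoidal for the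
cartesian monoidal structures (`exists_tensorIso_baseChangeHom`; Hartshorne II.3 Thm. 3.3,
`(X ×_k T) ×_k k' = X_{k'} ×_{k'} T_{k'}`) and `ℙʳ_ℂ ≅ ℙʳ_K ⊗_{K,σ} ℂ`
(`projectiveSpaceBaseChangeIso`, Liu Ex. 3.1.10). [cite: Hartshorne1977, II.3 Thm. 3.3]
[cite: Liu2002, Ex. 3.1.10] -/
theorem exists_iso_baseChangeHom_tensor_projectiveSpace {K : Type} [Field K] (σ : K →+* ℂ)
    (X₀ : SchemeOver K) {X : SchemeOver ℂ} (e : X ≅ (baseChangeHom σ).obj X₀) (r : ℕ) :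
    ∃ V₀ : SchemeOver K, Nonempty (X ⊗ projectiveSpace r ℂ ≅ (baseChangeHom σ).obj V₀) := by
  letI := σ.toAlgebra
  have e₂ : projectiveSpace r ℂ ≅ (baseChangeHom σ).obj (projectiveSpace r K) :=
    projectiveSpaceBaseChangeIso K ℂ r
  obtain ⟨e₃, -, -⟩ := exists_tensorIso_baseChangeHom σ X₀ (projectiveSpace r K)
  exact ⟨X₀ ⊗ projectiveSpace r K, ⟨tensorIso e e₂ ≪≫ e₃⟩⟩

/-- Hence: if `X` is definable over a number field, so is `X × ℙʳ_ℂ` (over the same field and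
embedding). [cite: Hartshorne1977, II.3 Thm. 3.3] -/
theorem isDefinableOverNumberField_tensor_projectiveSpace {X : SchemeOver ℂ}
    (hK : ∃ (K : Type) (_ : Field K) (_ : NumberField K) (σ : K →+* ℂ) (X₀ : SchemeOver K),
      Nonempty (X ≅ (baseChangeHom σ).obj X₀)) (r : ℕ) :
    ∃ (K : Type) (_ : Field K) (_ : NumberField K) (σ : K →+* ℂ) (V₀ : SchemeOver K),
      Nonempty (X ⊗ projectiveSpace r ℂ ≅ (baseChangeHom σ).obj V₀) := by
  obtain ⟨K, _, _, σ, X₀, ⟨e⟩⟩ := hK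
  obtain ⟨V₀, hV₀⟩ := exists_iso_baseChangeHom_tensor_projectiveSpace σ X₀ e r
  exact ⟨K, inferInstance, inferInstance, σ, V₀, hV₀⟩

/-! ### The crux reduced to the middle dimension of even-dimensional arithmetic varieties -/

/-- **`HCOverNumberFields` ⟺ its middle-dimensional case on even-dimensional arithmetic varieties.**
The Hodge conjecture for smooth projective complex varieties definable over a number field is
EQUIVALENT to: for every `m ≥ 2` and every smooth projective complex variety `X` of dimension `2m`
definable over a number field, every rational class of Hodge type `(m, m)` in `H^{2m}(X(ℂ); ℂ)` is
algebraic. (`⇒`: specialisation. `⇐`: by `hcOverNumberFields_iff_deepMiddle` only `2 ≤ p`,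
`2p ≤ n` matters; `2p = n` is the hypothesis and `2p < n` is the localised product half
`mem_algebraicClasses_of_two_mul_add_eq_of_middle_tensor` on the ARITHMETIC `2(n−p)`-fold
`X × ℙ^{n−2p}` (`isDefinableOverNumberField_tensor_projectiveSpace`), with `n − p ≥ 2`.) This is the
arithmetic form of BFNP Lemma 48 / Kerr–Pearlstein §3.1; it places the open content of the crux in
the middle cohomology of even-dimensional arithmetic varieties — where the Weil classes of CM
abelian varieties of Weil type live. [cite: BrosnanFangNiePearlstein2009, §6 Lemma 48]
[cite: KerrPearlstein2011, §3.1] [cite: Deligne1982HodgeCycles, §4] -/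
theorem hcOverNumberFields_iff_middleDimension :
    BoundaryReadout.HCOverNumberFields ↔
      ∀ ⦃m : ℕ⦄ ⦃X : SchemeOver ℂ⦄, 2 ≤ m → IsSmoothProjective (2 * m) X →
        (∃ (K : Type) (_ : Field K) (_ : NumberField K) (σ : K →+* ℂ) (X₀ : SchemeOver K),
          Nonempty (X ≅ (baseChangeHom σ).obj X₀)) →
        ∀ (c : complexBetti X (2 * m)), IsRationalClass c → IsOfHodgeType (2 * m) X (2 * m) m m c →
          c ∈ algebraicClasses X m := by
  refine ⟨fun h m X _ hX hK c hc hmm ↦ (h hX hK).2 m c hc hmm, fun h ↦ ?_⟩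
  refine hcOverNumberFields_iff_deepMiddle.2 fun n X hX hK p hp2 hpn c hc hpp ↦ ?_
  rcases Nat.eq_or_lt_of_le hpn with heq | hlt
  · -- the middle degree itself
    subst heq
    exact h hp2 hX hK c hc hpp
  · -- below the middle: the product half on the arithmetic `X × ℙ^{n - 2p}`
    have hdim : n + (n - 2 * p) = 2 * (p + (n - 2 * p)) := by omega
    have hV : IsSmoothProjective (2 * (p + (n - 2 * p))) (X ⊗ projectiveSpace (n - 2 * p) ℂ) :=
      hdim ▸ IsSmoothProjective.tensor_holds hX (isSmoothProjective_projectiveSpace_holds ℂ (n - 2 * p))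
    exact mem_algebraicClasses_of_two_mul_add_eq_of_middle_tensor hX (r := n - 2 * p) (by omega)
      (by omega) (h (by omega) hV (isDefinableOverNumberField_tensor_projectiveSpace hK _)) c hc hpp

/-- **Corollary (the shape consumed by sector attacks).** To prove the crux it suffices to prove, for
each `m ≥ 2` separately, the algebraicity of rational `(m,m)` classes on `2m`-dimensional arithmetic
varieties; in particular the FIRST open case of `HCOverNumberFields` is exactly: rational `(2,2)`
classes on smooth projective fourfolds definable over a number field are algebraic — granted the
cases `m ≥ 3`. [cite: BrosnanFangNiePearlstein2009, §6 Lemma 48] -/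
theorem hcOverNumberFields_of_middleDimension
    (h : ∀ ⦃m : ℕ⦄ ⦃X : SchemeOver ℂ⦄, 2 ≤ m → IsSmoothProjective (2 * m) X →
      (∃ (K : Type) (_ : Field K) (_ : NumberField K) (σ : K →+* ℂ) (X₀ : SchemeOver K),
        Nonempty (X ≅ (baseChangeHom σ).obj X₀)) →
      ∀ (c : complexBetti X (2 * m)), IsRationalClass c → IsOfHodgeType (2 * m) X (2 * m) m m c →
        c ∈ algebraicClasses X m) :
    BoundaryReadout.HCOverNumberFields :=
  hcOverNumberFields_iff_middleDimension.2 h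

/-! ### The André cut, needed only in the middle degree of even-dimensional arithmetic varieties -/

/-- **The André bridge in the middle degree.** The two open stubs of the registered André line of the
crux (`Cruxes/HCOverNumberFields/Lines/andre_transfer.lean` = the line of stmt-HodgeConjecture-11596:
B "rational `(p,p)` classes with `2 ≤ p`, `2p ≤ n` on `ℚ̄`-varieties are MOTIVATED", C "motivated
classes with `2 ≤ p ≤ n − 2` on `ℚ̄`-varieties are ALGEBRAIC") are needed ONLY IN THE MIDDLE DEGREE of
even-dimensional arithmetic varieties: if for every `m ≥ 2` and every smooth projective `X` of
dimension `2m` definable over a number field (B′) every rational `(m,m)` class lies in André's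
`A_motᵐ(X)_ℂ = motivatedClasses (2m) X m` and (C′) `motivatedClasses (2m) X m ≤ algebraicClasses X m`,
then `HCOverNumberFields` — by `hcOverNumberFields_iff_middleDimension`. (B′ is André 1996 §0.4
restricted to the middle degree of arithmetic varieties, a theorem on abelian varieties, Thm. 0.6.2;
C′ follows from the standard conjecture `B(X)`, §2.1.) A CONDITIONAL result recorded for the line
leads of stmt-1070 / stmt-11596: the registered stubs may be weakened to `2p = n`.
[cite: Andre1996Motifs, §0.4, Thm. 0.6.2 and §2.1] [cite: BrosnanFangNiePearlstein2009, §6 Lemma 48] -/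
theorem hcOverNumberFields_of_middle_motivated
    (hB : ∀ ⦃m : ℕ⦄ ⦃X : SchemeOver ℂ⦄, 2 ≤ m → IsSmoothProjective (2 * m) X →
      (∃ (K : Type) (_ : Field K) (_ : NumberField K) (σ : K →+* ℂ) (X₀ : SchemeOver K),
        Nonempty (X ≅ (baseChangeHom σ).obj X₀)) →
      ∀ (c : complexBetti X (2 * m)), IsRationalClass c → IsOfHodgeType (2 * m) X (2 * m) m m c →
        c ∈ motivatedClasses (2 * m) X m)
    (hC : ∀ ⦃m : ℕ⦄ ⦃X : SchemeOver ℂ⦄, 2 ≤ m → IsSmoothProjective (2 * m) X →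
      (∃ (K : Type) (_ : Field K) (_ : NumberField K) (σ : K →+* ℂ) (X₀ : SchemeOver K),
        Nonempty (X ≅ (baseChangeHom σ).obj X₀)) →
      motivatedClasses (2 * m) X m ≤ algebraicClasses X m) :
    BoundaryReadout.HCOverNumberFields :=
  hcOverNumberFields_iff_middleDimension.2 fun _ _ hm hX hK c hc hmm ↦
    hC hm hX hK (hB hm hX hK c hc hmm)

end Summit.HodgeConjecture.HodgeConjecture.Theorems

end
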